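import Literature.AlgebraicGeometry.HodgeTheory.IncidenceDivisorDescent
import Literature.AlgebraicGeometry.HodgeTheory.LinearSectionPencilFibres
import Literature.AlgebraicGeometry.HodgeTheory.HodgeIndexPrimitiveAlgebraicProofs
import Literature.AlgebraicGeometry.HodgeTheory.ComplexGysinRational
import Literature.AlgebraicGeometry.HodgeTheory.ComplexGysinHodgeType
import Literature.AlgebraicGeometry.HodgeTheory.GysinHodgeClassLiftProofs
import Literature.AlgebraicGeometry.HodgeTheory.AbelJacobiPullbackHodgeSection
import Literature.AlgebraicGeometry.HodgeTheory.HodgeTypeConjugation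
import Literature.AlgebraicGeometry.HodgeTheory.HodgeTypeExteriorProduct
import Literature.NumberTheory.Transcendental.DeRhamTheoremMultiplicative
import HarnessLib

/-!
# The pencil descent for algebraic classes below the middle dimension

Family `hodge`, layer `Literature/AlgebraicGeometry/HodgeTheory`. Everything here is a theorem (no
definitions, no named facts, D-0026).

Setting: `X` smooth projective of dimension `m + 1` over `ℂ`, a closed immersion `ι : X ⟶ ℙᴺ`,
two linear forms `a₀, a₁`, and the total space of the pencil they span,
`X̃ = {(x, b) ∈ X × ℙ¹ | a₀(x) b₁ = a₁(x) b₀}` (`Motives/LinearSectionNet`: `total ι a`,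
`emb : X̃ ⟶ X × ℙ¹`, `σ = blowDown = pr₁`, `π = proj = pr₂`; for a Bertini-general centre this is
the blow-up of `X` along the base locus and is smooth projective of dimension `m + 1`,
`Motives/LinearSectionNetBertini`). The main theorem `mem_algebraicClasses_of_pencil_spread` is the
DESCENT STEP of the printed induction (de Cataldo–Migliorini, arXiv:0711.1307v1 §4, proof of
Prop. 4.5, p. 11: "By (19) `Z' = g_* α + u^* β` […] Since `u^*` is injective in this range by Weak
Lefschetz, `β = N N₁ a + N N₂ ν L^{k/2}` […] The summand `g_* α` is algebraic by induction. It
follows that `u^* a` is algebraic"; Thomas 2005, proof of Prop. 2, p. 4: "by Lefschetz,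
`H^{2k}(X) → H^{2k}(𝒳) → H^{2k}(H_t)` is an isomorphism, so that the class of `π_* Z` on `X` is
`r N₁ A + r N₂ ωᵏ`"), for the tree's SUPPORT-defined algebraic classes `algebraicClasses = Nᵖ H²ᵖ`:
**if a rational `(p,p)`-class `a' ∈ Nᵖ H²ᵖ(X̃(ℂ); ℂ)` restricts on ONE smooth member
`X̃_t = π⁻¹(t)` of the pencil (with `2p ≤ m`) to the restriction of `c ∈ H²ᵖ(X(ℂ); ℂ)`, and rational
`(p−1,p−1)`-classes on `X` are algebraic (the inductive hypothesis in codimension `p − 1`), then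
`c ∈ Nᵖ H²ᵖ(X(ℂ); ℂ)`.** The spread class `a'` is what the spreading step of the printed proofs
(relative Hilbert scheme of `X̃/ℙ¹`, countability, a dominating component, a multisection) produces;
in the tree that step is the named fact `spread_algebraicClasses_over_projectiveLine`
(`HodgeTheory/SpreadAlgebraicClassesPencil`), consumed by the assembly file
`HodgeTheory/PencilStepBelowMiddleOfSpread`.

The descent replaces the blow-up decomposition (19) `Hᵏ(X̃) = u^* Hᵏ(X) ⊕ g_* Hᵏ⁻²(X_t)` (no carrier
in the tree) by the incidence-divisor calculus of `HodgeTheory/IncidenceDivisorDescent` on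
`X̃ ⊂ X × ℙ¹`, a smooth hyperplane section of the Segre embedding `X × ℙ¹ ↪ ℙ^{2N+1}` by the
incidence form `G = a₀(x) y₁ − a₁(x) y₀`:

1. weak Lefschetz for `emb` (`2p ≤ m`): `a' = emb^* ζ`, `emb^*` injective on `H²ᵖ(X × ℙ¹)`
   (Andreotti–Frankel + duality, range-based: `range_map_emb_eq_range_map_hypersurfaceSectionι`);
2. `s_t^* ζ = c` on the slice `X × {t}`: `u_t = (π⁻¹(t) ⟶ X̃ ⟶ X)` is injective on `H²ᵖ` (weak
   Lefschetz for the smooth member, `injective_complexBettiMap_fiberι_blowDown`) and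
   `u_t^* s_t^* ζ = (π⁻¹(t) ⟶ X̃)^* a' = u_t^* c`;
3. `Θ = toSegre^* h = pr₁^* w + pr₂^* η` with `η ≠ 0` (co-slices) and `w` ambient; `Θ` dies off `X̃`
   (the complement of a hyperplane is acyclic), so `Θ = emb_*(κ · 1)` (Thom–Gysin) and
   `ζ ∪ Θ = κ · emb_* a' ∈ N^{p+1}(X × ℙ¹)`;
4. ONE rung of the coniveau ladder: `pr_{1*}(ζ ∪ Θ) = w ∪ pr_{1*} ζ + λ · s_t^* ζ ∈ Nᵖ(X)`, `λ ≠ 0`;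
5. `pr_{1*} ζ ∈ N^{p−1}(X)` by the INDUCTIVE HYPOTHESIS: `ζ` is rational and of type `(p,p)`
   (an injective pull-back reflects rationality and Hodge types: `IsRationalClass.of_apply_of_injective'`,
   `IsOfHodgeType.of_map_of_injective`), so `pr_{1*} ζ` is a non-zero multiple of a rational
   `(p−1,p−1)`-class (`exists_smul_isRationalClass_complexGysin`, `isOfHodgeType_complexGysin`) —
   this is where the printed proofs use "the summand `g_* α` is algebraic by induction";
6. hence `λ c ∈ Nᵖ(X)`.

Also proved here: the small inputs on `X̃ ⊂ X × ℙ¹` (the incidence form is the linear form of its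
coefficient vector, `zeroLocus (forms a) = zeroLocus {G}`, the complex points of `X̃` are those of
the hyperplane section of `X × ℙ¹` by `G`, `Θ` dies off `X̃`, co-slices see `η ≠ 0`), and the two
rationality lemmas in two-space form (ports of their Summits-side twins in
`Summits/HodgeConjecture/HodgeConjecture/Theorems/LinearSystemTorelliPencilReductionHodgeTypes`, which
Literature cannot import).

## References

* [DecataldoMigliorini2009] M. A. de Cataldo, L. Migliorini, On singularities of primitive
  cohomology classes, Proc. AMS 137 (2009) 3593–3600; §4 proof of Prop. 4.5 (arXiv:0711.1307v1
  pp. 10–11).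
* [Thomas2005Nodes] R. P. Thomas, Nodes and the Hodge conjecture, J. Algebraic Geom. 14 (2005)
  177–185, §2 proof of Prop. 2 (arXiv:math/0212216, p. 4).
* [VoisinHodgeII2003] C. Voisin, Hodge Theory and Complex Algebraic Geometry II (2003), §1.2.2
  Thm. 1.22–1.23, §2.1.1, §2.3.1, §6.1.1.
* [VoisinHodgeI2002] C. Voisin, Hodge Theory and Complex Algebraic Geometry I (2002), §7.1.1–7.1.2,
  §7.3.2, §11.3.2.
* [FultonYoungTableaux1997] W. Fulton, Young Tableaux (1997), Appendix B §B.1 (5)–(7).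
* [Hartshorne1977] R. Hartshorne, Algebraic Geometry (1977), II Example 7.17.3, II Ex. 5.11.
-/

noncomputable section

open scoped Manifold ContDiff
open CategoryTheory CategoryTheory.Limits AlgebraicGeometry MonoidalCategory CartesianMonoidalCategory
open Literature.AlgebraicTopology.SingularHomology
open Literature.AlgebraicGeometry.Motives

namespace Literature.AlgebraicGeometry.HodgeTheory

section HodgeTheory

/-! ### Rationality through injective maps and through Gysin morphisms (two-space forms) -/

/-- **Rational descent along an injective map preserving rational classes, between two spaces**
(the tree's `IsRationalClass.of_apply_of_injective` with an arbitrary target space; same proof: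
complexify a `ℚ`-basis of `Hᵏ(X(ℂ); ℚ)`, which spans `Hᵏ(X(ℂ); ℂ)` for `X` smooth projective).
Port of the Summits-side helper of the same name. [cite: VoisinHodgeI2002, §7.1.1 and §7.1.2]
[cite: HatcherAT2002, §3.1 Thm. 3.2 and p. 198] -/
theorem IsRationalClass.of_apply_of_injective' {n k m : ℕ} {X : SchemeOver ℂ} (hX : IsSmoothProjective n X)
    {T : Type} [TopologicalSpace T] (f : complexBetti X k →ₗ[ℂ] singularCohomology ℂ ℂ T m)
    (hf : Function.Injective f) (hfQ : ∀ c : complexBetti X k, IsRationalClass c → IsRationalClass (f c))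
    {c : complexBetti X k} (hc : IsRationalClass (f c)) : IsRationalClass c := by
  classical
  haveI := finite_singularCohomology_rat_complexPoints hX k
  set b := Module.finBasis ℚ (singularCohomology ℚ ℚ (ComplexPoints X) k) with hb
  set v : Fin (Module.finrank ℚ (singularCohomology ℚ ℚ (ComplexPoints X) k)) → complexBetti X k :=
    fun i ↦ singularCohomology.ringChange (algebraMap ℚ ℂ) (ComplexPoints X) k (b i) with hv
  have hv_span : (⊤ : Submodule ℂ (complexBetti X k)) ≤ Submodule.span ℂ (Set.range v) := by
    rw [← span_isRationalClass_eq_top_of_isSmoothProjective_holds n X hX k, Submodule.span_le]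
    intro c' hc'
    obtain ⟨x, rfl⟩ := IsRationalClass.exists_ringChange_eq hc'
    have hx : x ∈ Submodule.span ℚ (Set.range b) := by
      rw [b.span_eq]
      exact Submodule.mem_top
    have h1 := ringChange_mem_span_image_of_mem_span hx
    rwa [← Set.range_comp] at h1
  have hw : ∀ i, ∃ y : singularCohomology ℚ ℚ T m,
      singularCohomology.ringChange (algebraMap ℚ ℂ) T m y = f (v i) :=
    fun i ↦ IsRationalClass.exists_ringChange_eq (hfQ _ (isRationalClass_ringChange (b i)))
  choose y hy using hw
  obtain ⟨z, hz⟩ := IsRationalClass.exists_ringChange_eq hc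
  have hfc_mem : f c ∈ Submodule.span ℂ (Set.range fun i ↦ f (v i)) := by
    have h1 : f c ∈ (Submodule.span ℂ (Set.range v)).map f :=
      Submodule.mem_map_of_mem (hv_span Submodule.mem_top)
    rwa [Submodule.map_span, ← Set.range_comp] at h1
  have hz_mem : z ∈ Submodule.span ℚ (Set.range y) := by
    rw [← ringChange_mem_span_image_iff (Submodule.span ℚ (Set.range y)) z, hz]
    refine Submodule.span_mono ?_ hfc_mem
    rintro _ ⟨i, rfl⟩
    exact ⟨y i, Submodule.subset_span ⟨i, rfl⟩, hy i⟩
  obtain ⟨q, hq⟩ := Submodule.mem_span_range_iff_exists_fun ℚ |>.1 hz_mem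
  have hfc : f c = f (singularCohomology.ringChange (algebraMap ℚ ℂ) (ComplexPoints X) k
      (∑ i, q i • b i)) := by
    rw [← hz, ← hq, ringChange_sum_smul, ringChange_sum_smul, map_sum]
    refine Finset.sum_congr rfl fun i _ ↦ ?_
    rw [map_smul, hy i]
  rw [hf hfc]
  exact isRationalClass_ringChange _

/-- **Gysin morphisms map rational classes to a fixed non-zero multiple of rational classes**
(`complexGysin μ` is `u •` the rational Gysin morphism on rational classes, `u ≠ 0`:
`complexGysin_ringChange_eq_smul_gysinMap`; in degrees above `2 dim Y` it vanishes). Port of the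
Summits-side helper of the same name. [cite: VoisinHodgeI2002, §7.3.2]
[cite: FultonYoungTableaux1997, Appendix B §B.1 (5)] -/
theorem exists_smul_isRationalClass_complexGysin (μ : OrientationFamily) {m n : ℕ} {Y X : SchemeOver ℂ}
    (hY : IsSmoothProjective m Y) (hX : IsSmoothProjective n X) (f : Y ⟶ X) {a b : ℕ}
    (hab : a + 2 * n = b + 2 * m) :
    ∃ u : ℂ, u ≠ 0 ∧ ∀ y : complexBetti Y a, IsRationalClass y →
      ∃ r : complexBetti X b, IsRationalClass r ∧ complexGysin μ hY hX f hab y = u • r := by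
  by_cases ha : a ≤ 2 * m
  · have hμ : μ.HasPoincareDuality := OrientationFamily.hasPoincareDuality μ
    obtain ⟨νY⟩ := Motives.ComplexPoints.isOrientableOver ℚ hY
    obtain ⟨νX, hνX⟩ := exists_ratOrientation_hasPoincareDuality hX
    obtain ⟨u, hu0, hu⟩ := complexGysin_ringChange_eq_smul_gysinMap hμ hY hX f (a := a) (b := b)
      (q := 2 * m - a) (by omega) (by omega) νY νX hνX
    refine ⟨u, hu0, fun y hy ↦ ?_⟩
    obtain ⟨y₀, rfl⟩ := IsRationalClass.exists_ringChange_eq hy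
    exact ⟨_, isRationalClass_ringChange _, hu y₀⟩
  · refine ⟨1, one_ne_zero, fun y _ ↦ ⟨0, IsRationalClass.zero, ?_⟩⟩
    rw [complexGysin_of_lt hY hX f hab (not_le.1 ha), LinearMap.zero_apply, smul_zero]

/-! ### The total space of a pencil is the hyperplane section of `X × ℙ¹ ↪ ℙ^{2N+1}` by the incidence form -/

section PencilInProduct

variable {N : ℕ} (a : Fin 2 → Fin (N + 1) → ℂ)

/-- The coefficient vector of the incidence form `G = a₀(x) y₁ − a₁(x) y₀` in the Segre coordinates
`z_{(c,d)} = x_c y_d`: `a₀c` at `(c, 1)`, `−a₁c` at `(c, 0)`. [cite: Hartshorne1977, II Example 7.17.3] -/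
theorem linForm_pencilCoeff_eq_incidenceForm :
    linForm (N * 1 + N + 1) (fun j ↦ ![-a 1 ((segreIndexEquiv N 1).symm j).1,
      a 0 ((segreIndexEquiv N 1).symm j).1] ((segreIndexEquiv N 1).symm j).2) =
      LinearSectionNet.incidenceForm a ((0 : Fin 2), (1 : Fin 2)) := by
  rw [linForm, LinearSectionNet.incidenceForm, LinearSectionNet.mulForm, LinearSectionNet.mulForm,
    ← Equiv.sum_comp (segreIndexEquiv N 1), Fintype.sum_prod_type]
  simp only [Equiv.symm_apply_apply, Fin.sum_univ_succ, Fin.sum_univ_zero, add_zero,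
    Matrix.cons_val_zero, Matrix.cons_val_succ, Matrix.cons_val_fin_one, Fin.succ_zero_eq_one,
    map_neg, neg_mul, Finset.sum_add_distrib, Finset.sum_neg_distrib]
  abel

/-- The coefficient vector of the incidence form is non-zero as soon as `(a₀, a₁) ≠ 0`. [folklore] -/
theorem pencilCoeff_ne_zero (ha : a ≠ 0) :
    (fun j ↦ ![-a 1 ((segreIndexEquiv N 1).symm j).1,
      a 0 ((segreIndexEquiv N 1).symm j).1] ((segreIndexEquiv N 1).symm j).2) ≠ 0 := by
  intro h
  apply ha
  have key : ∀ (c : Fin (N + 1)) (d : Fin 2), (![-a 1 c, a 0 c] : Fin 2 → ℂ) d = 0 := by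
    intro c d
    have := congr_fun h (segreIndexEquiv N 1 (c, d))
    simpa only [Equiv.symm_apply_apply, Pi.zero_apply] using this
  funext i c
  fin_cases i
  · simpa using key c 1
  · simpa using key c 0

/-- The incidence forms `{aᵢ yⱼ − aⱼ yᵢ}` of a pencil have the same zero locus as the single form
`G = a₀ y₁ − a₁ y₀` (the others are `0` and `−G`). [folklore] -/
theorem zeroLocus_forms_eq :
    letI : GradedAlgebra (Segre.grading (Fin (N * 1 + N + 1 + 1)) ℂ) := MvPolynomial.gradedAlgebra
    ProjectiveSpectrum.zeroLocus (Segre.grading (Fin (N * 1 + N + 1 + 1)) ℂ) (LinearSectionNet.forms a) =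
      ProjectiveSpectrum.zeroLocus (Segre.grading (Fin (N * 1 + N + 1 + 1)) ℂ)
        {LinearSectionNet.incidenceForm a ((0 : Fin 2), (1 : Fin 2))} := by
  letI : GradedAlgebra (Segre.grading (Fin (N * 1 + N + 1 + 1)) ℂ) := MvPolynomial.gradedAlgebra
  ext x
  simp only [ProjectiveSpectrum.mem_zeroLocus, Set.singleton_subset_iff, SetLike.mem_coe,
    LinearSectionNet.forms, Set.range_subset_iff]
  constructor
  · intro h
    exact h _
  · rintro h ⟨i, j⟩
    have h00 : ∀ i : Fin 2, LinearSectionNet.incidenceForm a (i, i) ∈ x.asHomogeneousIdeal := by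
      intro i
      rw [LinearSectionNet.incidenceForm, sub_self]
      exact zero_mem _
    have h10 : LinearSectionNet.incidenceForm a ((1 : Fin 2), (0 : Fin 2)) =
        -LinearSectionNet.incidenceForm a ((0 : Fin 2), (1 : Fin 2)) := by
      simp only [LinearSectionNet.incidenceForm, neg_sub]
    have key : ∀ i j : Fin (1 + 1), i = j ∨ (i = 0 ∧ j = 1) ∨ (i = 1 ∧ j = 0) := by decide
    rcases key i j with rfl | ⟨rfl, rfl⟩ | ⟨rfl, rfl⟩
    · exact h00 i
    · exact h
    · rw [h10]
      exact Submodule.neg_mem _ h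

variable {X : SchemeOver ℂ} (ι : X ⟶ projectiveSpace N ℂ) [IsClosedImmersion ι.left]

/-- `X × ℙ¹ → ℙᴺ × ℙ¹ → ℙ^{2N+1}` (`ι` on the first factor, then Segre) is a closed immersion.
[cite: Hartshorne1977, II Ex. 5.11] -/
theorem isClosedImmersion_toSegre_id_left :
    IsClosedImmersion (Incidence.toSegre ι (𝟙 (projectiveSpace 1 ℂ))).left := by
  haveI : IsClosedImmersion (𝟙 (projectiveSpace 1 ℂ) : projectiveSpace 1 ℂ ⟶ _).left := by
    rw [Over.id_left]; infer_instance
  infer_instance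

/-- **The complex points of `X̃ ⊆ X × ℙ¹` are those of the hyperplane section of
`X × ℙ¹ ↪ ℙ^{2N+1}` by the incidence form** (both closed immersions have underlying closed set
`toSegre⁻¹ V₊(a₀ y₁ − a₁ y₀)`). [cite: Hartshorne1977, II Example 7.17.3 and II Ex. 5.11] -/
theorem range_map_emb_eq_range_map_hypersurfaceSectionι_pencil :
    Set.range (AlgPoints.map (L := ℂ) (LinearSectionNet.emb ι a)) =
      Set.range (AlgPoints.map (L := ℂ)
        ((⟨_, Incidence.toSegre ι (𝟙 (projectiveSpace 1 ℂ)), isClosedImmersion_toSegre_id_left ι⟩ :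
            ProjectiveEmbedding (X ⊗ projectiveSpace 1 ℂ)).hypersurfaceSectionι
          (LinearSectionNet.incidenceForm a ((0 : Fin 2), (1 : Fin 2)))
          (LinearSectionNet.isHomogeneous_incidenceForm a _))) := by
  have hL : Set.range (AlgPoints.map (L := ℂ) (LinearSectionNet.emb ι a)) =
      {Q | Q.pt ∈ Set.range (LinearSectionNet.emb ι a).left} := by
    ext Q
    constructor
    · rintro ⟨P, rfl⟩
      exact AlgPoints.pt_map_mem_range _ P
    · intro h
      exact ⟨AlgPoints.liftClosed _ Q h, AlgPoints.map_liftClosed _ _ h⟩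
  have hR : Set.range (AlgPoints.map (L := ℂ)
      ((⟨_, Incidence.toSegre ι (𝟙 (projectiveSpace 1 ℂ)), isClosedImmersion_toSegre_id_left ι⟩ :
          ProjectiveEmbedding (X ⊗ projectiveSpace 1 ℂ)).hypersurfaceSectionι
        (LinearSectionNet.incidenceForm a ((0 : Fin 2), (1 : Fin 2)))
        (LinearSectionNet.isHomogeneous_incidenceForm a _))) =
      {Q | Q.pt ∈ Set.range ((⟨_, Incidence.toSegre ι (𝟙 (projectiveSpace 1 ℂ)),
          isClosedImmersion_toSegre_id_left ι⟩ :
          ProjectiveEmbedding (X ⊗ projectiveSpace 1 ℂ)).hypersurfaceSectionι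
        (LinearSectionNet.incidenceForm a ((0 : Fin 2), (1 : Fin 2)))
        (LinearSectionNet.isHomogeneous_incidenceForm a _)).left} := by
    ext Q
    constructor
    · rintro ⟨P, rfl⟩
      exact AlgPoints.pt_map_mem_range _ P
    · intro h
      exact ⟨AlgPoints.liftClosed _ Q h, AlgPoints.map_liftClosed _ _ h⟩
  letI : GradedAlgebra (Segre.grading (Fin (N * 1 + N + 1 + 1)) ℂ) := MvPolynomial.gradedAlgebra
  rw [hL, hR, range_hypersurfaceSectionι _ _ _ one_pos, LinearSectionNet.range_emb]
  ext Q
  simp only [Set.mem_setOf_eq, Set.mem_preimage]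
  change Q.pt ∈ (Incidence.toSegre ι (𝟙 (projectiveSpace 1 ℂ))).left ⁻¹'
      ProjectiveSpectrum.zeroLocus _ (LinearSectionNet.forms a) ↔ _
  rw [zeroLocus_forms_eq]
  rfl

omit [IsClosedImmersion ι.left] in
/-- **The class of the incidence divisor dies off `X̃`**: for every `h ∈ H²(ℙ^{2N+1}(ℂ); ℂ)` the
class `toSegre^* h` on `(X × ℙ¹)(ℂ)` restricts to zero on the complement of `emb(X̃)` — it is
pulled back from the complement of the hyperplane `{a₀ y₁ = a₁ y₀}` of `ℙ^{2N+1}`, which is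
acyclic (`(a₀, a₁) ≠ 0`). [cite: VoisinHodgeII2003, §2.1.1 and §1.2.3 Cor. 1.24] -/
theorem restrictCompl_range_emb_map_toSegre_id_eq_zero (ha : a ≠ 0)
    (h : complexBetti (projectiveSpace (N * 1 + N + 1) ℂ) 2) :
    complexBetti.restrictCompl (X ⊗ projectiveSpace 1 ℂ)
      (Set.range (LinearSectionNet.emb ι a).left.base) 2
        (complexBetti.map (Incidence.toSegre ι (𝟙 (projectiveSpace 1 ℂ))) 2 h) = 0 := by
  letI : GradedAlgebra (Segre.grading (Fin (N * 1 + N + 1 + 1)) ℂ) := MvPolynomial.gradedAlgebra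
  set g : Fin (N * 1 + N + 1 + 1) → ℂ := fun j ↦ ![-a 1 ((segreIndexEquiv N 1).symm j).1,
      a 0 ((segreIndexEquiv N 1).symm j).1] ((segreIndexEquiv N 1).symm j).2 with hgdef
  have hg : LinearIndependent ℂ (fun _ : Fin 1 ↦ g) :=
    linearIndependent_unique_iff.2 (pencilCoeff_ne_zero a ha)
  haveI := subsingleton_singularCohomology_complexPointsCompl_linearSubspace (m := 0) hg (k := 2)
    (by norm_num)
  have h0 := restrictCompl_preimage_map_eq_zero (Incidence.toSegre ι (𝟙 (projectiveSpace 1 ℂ)))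
    (linearSubspace (N * 1 + N + 1) (fun _ : Fin 1 ↦ g)) 2 h
  have hset : (Set.range (LinearSectionNet.emb ι a).left.base) =
      (Incidence.toSegre ι (𝟙 (projectiveSpace 1 ℂ))).left.base ⁻¹'
        linearSubspace (N * 1 + N + 1) (fun _ : Fin 1 ↦ g) := by
    rw [LinearSectionNet.range_emb, linearSubspace, Set.range_const, hgdef,
      linForm_pencilCoeff_eq_incidenceForm, ← zeroLocus_forms_eq]
    rfl
  rw [hset]
  exact h0

/-- **A hyperplane-type class restricts non-trivially to the co-slices `{x} × ℙ¹`**: for `x ∈ X(ℂ)`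
and `h ≠ 0` in `H²(ℙ^{2N+1}(ℂ); ℂ)`, `({x} × ℙ¹ ⟶ X × ℙ¹ ⟶ ℙ^{2N+1})^* h ≠ 0` — the composite is a
closed immersion of `ℙ¹` (a section of the separated `pr₂`, then `toSegre`), and non-zero degree-`2`
classes restrict non-trivially to positive-dimensional smooth closed subvarieties
(`complexBetti_map_two_ne_zero_of_isClosedImmersion`). [cite: VoisinHodgeI2002, §3.3.2 Lemma 3.16 and §7.1.2] -/
theorem complexBetti_map_coslice_toSegre_id_ne_zero {n : ℕ} (hX : IsSmoothProjective n X)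
    (x : ComplexPoints X) {h : complexBetti (projectiveSpace (N * 1 + N + 1) ℂ) 2} (hh : h ≠ 0) :
    complexBetti.map (CartesianMonoidalCategory.lift (toSpecOver (projectiveSpace 1 ℂ) ≫ x)
      (𝟙 (projectiveSpace 1 ℂ)) ≫ Incidence.toSegre ι (𝟙 (projectiveSpace 1 ℂ))) 2 h ≠ 0 := by
  have hP : IsSmoothProjective 1 (projectiveSpace 1 ℂ) := isSmoothProjective_projectiveSpace' 1
  set r : projectiveSpace 1 ℂ ⟶ X ⊗ projectiveSpace 1 ℂ :=
    CartesianMonoidalCategory.lift (toSpecOver (projectiveSpace 1 ℂ) ≫ x) (𝟙 (projectiveSpace 1 ℂ))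
    with hrdef
  haveI : IsClosedImmersion (r.left ≫ (snd X (projectiveSpace 1 ℂ)).left) := by
    rw [← Over.comp_left, hrdef, CartesianMonoidalCategory.lift_snd, Over.id_left]
    infer_instance
  haveI : IsSeparated (snd X (projectiveSpace 1 ℂ)).left := by
    haveI : IsProper X.hom := IsSmoothProjective.isProper_holds hX
    change IsSeparated (pullback.snd X.hom (projectiveSpace 1 ℂ).hom)
    infer_instance
  haveI : IsClosedImmersion r.left :=
    IsClosedImmersion.of_comp r.left (snd X (projectiveSpace 1 ℂ)).left
  haveI := isClosedImmersion_toSegre_id_left ι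
  haveI : IsClosedImmersion (r ≫ Incidence.toSegre ι (𝟙 (projectiveSpace 1 ℂ))).left := by
    rw [Over.comp_left]
    infer_instance
  exact complexBetti_map_two_ne_zero_of_isClosedImmersion hP le_rfl
    (r ≫ Incidence.toSegre ι (𝟙 (projectiveSpace 1 ℂ))) hh

end PencilInProduct

/-! ### The descent -/

set_option maxHeartbeats 800000 in
/-- **The pencil descent.** Let `X` be smooth projective of dimension `m + 1` with a closed immersion
`ι : X ⟶ ℙᴺ`, let `a = (a₀, a₁) ≠ 0` be two linear forms whose pencil has smooth projective total
space `X̃ ⊆ X × ℙ¹` of dimension `m + 1`, and let `t ∈ ℙ¹(ℂ)` be a point whose fibre `π⁻¹(t)` is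
smooth projective. Let `2(q+1) ≤ m` and suppose that every rational class of type `(q, q)` in
`H^{2q}(X(ℂ); ℂ)` is algebraic (the inductive hypothesis in codimension `q`). If an algebraic,
rational, `(q+1, q+1)`-class `a'` on `X̃` and a class `c ∈ H^{2q+2}(X(ℂ); ℂ)` have the same
restriction to `π⁻¹(t)` (along `π⁻¹(t) ⟶ X̃` and `π⁻¹(t) ⟶ X̃ ⟶ X`), then `c` is algebraic,
`c ∈ N^{q+1} H^{2q+2}(X(ℂ); ℂ)`. This is the descent through the pencil of the printed proofs
(de Cataldo–Migliorini: "By (19) `Z' = g_* α + u^* β` […] `g_* α` is algebraic by induction. It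
follows that `u^* a` is algebraic"; Thomas: "by Lefschetz […] the class of `π_* Z` on `X` is
`r N₁ A + r N₂ ωᵏ`"), realised through the incidence-divisor calculus on `X̃ ⊂ X × ℙ¹` (module
docstring, steps 1–6) instead of the blow-up decomposition (19).
[cite: DecataldoMigliorini2009, §4 proof of Prop. 4.5 (arXiv v1 p. 11)]
[cite: Thomas2005Nodes, §2 proof of Prop. 2, case k < d/2 (p. 4)]
[cite: VoisinHodgeII2003, §1.2.2 Thm. 1.23, §2.3.1 and §6.1.1]
[cite: FultonYoungTableaux1997, Appendix B §B.1 (5)–(7)] -/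
theorem mem_algebraicClasses_of_pencil_spread {m N : ℕ} {X : SchemeOver ℂ}
    (hX : IsSmoothProjective (m + 1) X) (ι : X ⟶ projectiveSpace N ℂ) [IsClosedImmersion ι.left]
    {a : Fin 2 → Fin (N + 1) → ℂ} (ha : a ≠ 0)
    (hXt : IsSmoothProjective (m + 1) (LinearSectionNet.total ι a)) {q : ℕ} (hqm : 2 * (q + 1) ≤ m)
    (hIH : ∀ c' : complexBetti X (2 * q), IsRationalClass c' → IsOfHodgeType (m + 1) X (2 * q) q q c' →
      c' ∈ algebraicClasses X q)
    (c : complexBetti X (2 * (q + 1))) {a' : complexBetti (LinearSectionNet.total ι a) (2 * (q + 1))}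
    (ha'N : a' ∈ algebraicClasses (LinearSectionNet.total ι a) (q + 1)) (ha'Q : IsRationalClass a')
    (ha'H : IsOfHodgeType (m + 1) (LinearSectionNet.total ι a) (2 * (q + 1)) (q + 1) (q + 1) a')
    (t : ComplexPoints (projectiveSpace 1 ℂ)) {n' : ℕ}
    (hY : IsSmoothProjective n' (fiberOver (LinearSectionNet.proj ι a) t))
    (ht : complexBetti.map (fiberι (LinearSectionNet.proj ι a) t) (2 * (q + 1)) a' =
      complexBetti.map (fiberι (LinearSectionNet.proj ι a) t ≫ LinearSectionNet.blowDown ι a)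
        (2 * (q + 1)) c) :
    c ∈ algebraicClasses X (q + 1) := by
  -- the players
  have hP : IsSmoothProjective 1 (projectiveSpace 1 ℂ) := isSmoothProjective_projectiveSpace' 1
  have hV : IsSmoothProjective (m + 1 + 1) (X ⊗ projectiveSpace 1 ℂ) :=
    IsSmoothProjective.tensor_holds hX hP
  let μ : OrientationFamily := fun _ _ hZ ↦ (ComplexPoints.isOrientableOver ℂ hZ).some
  have hμ : μ.HasPoincareDuality := OrientationFamily.hasPoincareDuality μ
  have hS := gysinMap_restrictCompl_eq_zero_of_field.{0, 0} ℂ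
  -- (0) `u_t = π⁻¹(t) ⟶ X̃ ⟶ X` is injective on `H^{2q+2}` (weak Lefschetz for the smooth member)
  have hu : Function.Injective (complexBetti.map
      (fiberι (LinearSectionNet.proj ι a) t ≫ LinearSectionNet.blowDown ι a) (2 * (q + 1))) :=
    injective_complexBettiMap_fiberι_blowDown ι a hX t hY hqm
  -- (1) weak Lefschetz for `emb : X̃ ⟶ X × ℙ¹`: `a' = emb^* ζ`, `emb^*` injective on `H^{2q+2}`
  have hAF1 := HypersurfaceSectionComplement.isZero_singularHomology_compl_range_hypersurfaceSectionι
    (R := ℂ) (M₀ := ℂ) hV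
    (⟨_, Incidence.toSegre ι (𝟙 (projectiveSpace 1 ℂ)), isClosedImmersion_toSegre_id_left ι⟩ :
      ProjectiveEmbedding (X ⊗ projectiveSpace 1 ℂ))
    le_rfl (LinearSectionNet.incidenceForm a ((0 : Fin 2), (1 : Fin 2)))
    (LinearSectionNet.isHomogeneous_incidenceForm a _) (j := 2 * (m + 1 + 1) - 1 - 2 * (q + 1)) (by omega)
  have hAF2 := HypersurfaceSectionComplement.isZero_singularHomology_compl_range_hypersurfaceSectionι
    (R := ℂ) (M₀ := ℂ) hV
    (⟨_, Incidence.toSegre ι (𝟙 (projectiveSpace 1 ℂ)), isClosedImmersion_toSegre_id_left ι⟩ :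
      ProjectiveEmbedding (X ⊗ projectiveSpace 1 ℂ))
    le_rfl (LinearSectionNet.incidenceForm a ((0 : Fin 2), (1 : Fin 2)))
    (LinearSectionNet.isHomogeneous_incidenceForm a _) (j := 2 * (m + 1 + 1) - 2 * (q + 1)) (by omega)
  rw [← range_map_emb_eq_range_map_hypersurfaceSectionι_pencil a ι] at hAF1 hAF2
  obtain ⟨ζ, rfl⟩ := surjective_complexBettiMap_of_isZero_singularHomology_compl_range hV hXt
    (LinearSectionNet.emb ι a) (j := 2 * (m + 1 + 1) - 1 - 2 * (q + 1)) (by omega) hAF1 a'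
  have hinj : Function.Injective (complexBetti.map (LinearSectionNet.emb ι a) (2 * (q + 1))) :=
    injective_complexBettiMap_of_isZero_singularHomology_compl_range hV hXt (LinearSectionNet.emb ι a)
      (j := 2 * (m + 1 + 1) - 2 * (q + 1)) (by omega) hAF2
  -- (2) `s_t^* ζ = c`
  have hsζ : complexBetti.map (sliceAt X t) (2 * (q + 1)) ζ = c := by
    apply hu
    rw [← CategoryTheory.comp_apply, ← complexBetti.map_comp, ← fiberι_emb_eq_sliceAt,
      complexBetti.map_comp, CategoryTheory.comp_apply, ht]
  -- (3) `ζ` is rational and of type `(q+1, q+1)` (injective `emb^*` reflects both)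
  have hζQ : IsRationalClass ζ :=
    IsRationalClass.of_apply_of_injective' hV (complexBetti.map (LinearSectionNet.emb ι a) (2 * (q + 1))).hom
      hinj (fun c' hc' ↦ hc'.map _) ha'Q
  have hζH : IsOfHodgeType (m + 1 + 1) (X ⊗ projectiveSpace 1 ℂ) (2 * (q + 1)) (q + 1) (q + 1) ζ :=
    IsOfHodgeType.of_map_of_injective hXt hV (LinearSectionNet.emb ι a) (by omega) hinj ha'H
  -- (4) `pr_{1*} ζ ∈ N^q(X)` by the inductive hypothesis
  have hπ₀ : complexGysin μ hV hX (fst X (projectiveSpace 1 ℂ))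
      (show 2 * (q + 1) + 2 * (m + 1) = 2 * q + 2 * (m + 1 + 1) by omega) ζ ∈ algebraicClasses X q := by
    obtain ⟨u, hu0, hu⟩ := exists_smul_isRationalClass_complexGysin μ hV hX (fst X (projectiveSpace 1 ℂ))
      (show 2 * (q + 1) + 2 * (m + 1) = 2 * q + 2 * (m + 1 + 1) by omega)
    obtain ⟨r, hrQ, hr⟩ := hu ζ hζQ
    have hgH : IsOfHodgeType (m + 1) X (2 * q) q q (complexGysin μ hV hX (fst X (projectiveSpace 1 ℂ))
        (show 2 * (q + 1) + 2 * (m + 1) = 2 * q + 2 * (m + 1 + 1) by omega) ζ) :=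
      isOfHodgeType_complexGysin hodgePQ_independent_of_hodgeModel_holds (fun _ _ ↦ nonempty_hodgeModel_holds)
        (fun E _ _ _ ↦ Literature.NumberTheory.Transcendental.exists_deRhamIsoFamily_holds E) μ hV hX
        (fst X (projectiveSpace 1 ℂ)) _ (by omega) (by omega) hζH
    have hrH : IsOfHodgeType (m + 1) X (2 * q) q q r := by
      have h1 : r = u⁻¹ • complexGysin μ hV hX (fst X (projectiveSpace 1 ℂ))
          (show 2 * (q + 1) + 2 * (m + 1) = 2 * q + 2 * (m + 1 + 1) by omega) ζ := by
        rw [hr, smul_smul, inv_mul_cancel₀ hu0, one_smul]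
      rw [h1]
      exact hgH.smul _
    rw [hr]
    exact Submodule.smul_mem _ u (hIH r hrQ hrH)
  -- (5) the class `Θ = toSegre^* h₂` of the incidence divisor, `h₂ ≠ 0` in `H²(ℙ^{2N+1})`
  obtain ⟨h₂, hh₂⟩ : ∃ h₂ : complexBetti (projectiveSpace (N * 1 + N + 1) ℂ) 2, h₂ ≠ 0 := by
    have h1 : Module.finrank ℂ (complexBetti (projectiveSpace (N * 1 + N + 1) ℂ) 2) = 1 :=
      finrank_complexBetti_projectiveSpace_two_mul_eq_one _ (p := 1) (by omega)
    haveI := Module.nontrivial_of_finrank_eq_succ h1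
    exact exists_ne 0
  set Θ : complexBetti (X ⊗ projectiveSpace 1 ℂ) 2 :=
    complexBetti.map (Incidence.toSegre ι (𝟙 (projectiveSpace 1 ℂ))) 2 h₂ with hΘdef
  -- (6) `Θ = emb_* (κ • 1)` (Thom–Gysin for the smooth divisor `X̃`)
  have hΘsupp := restrictCompl_range_emb_map_toSegre_id_eq_zero a ι ha h₂
  obtain ⟨y, hy⟩ := exists_complexGysin_eq_of_isClosedImmersion μ hV hXt (LinearSectionNet.emb ι a)
    (a := 0) (b := 2) (show 0 + 2 * (m + 1 + 1) = 2 + 2 * (m + 1) by omega) hΘsupp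
  obtain ⟨κ, rfl⟩ := exists_eq_smul_one μ hXt y
  -- (7) `ζ ∪ Θ = κ • emb_* (emb^* ζ) ∈ N^{q+2}`
  have hζΘ : cupProduct rfl ζ Θ ∈ algebraicClasses (X ⊗ projectiveSpace 1 ℂ) (q + 1 + 1) := by
    have key : cupProduct rfl ζ Θ = κ • complexGysin μ hXt hV (LinearSectionNet.emb ι a)
        (show 2 * (q + 1) + 2 * (m + 1 + 1) = (2 * (q + 1) + 2) + 2 * (m + 1) by omega)
        (complexBetti.map (LinearSectionNet.emb ι a) (2 * (q + 1)) ζ) := by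
      rw [hΘdef, ← hy, map_smul, map_smul, ← complexGysin_cup hμ hXt hV (LinearSectionNet.emb ι a)
        (Nat.add_zero (2 * (q + 1))) _ (show 0 + 2 * (m + 1 + 1) = 2 + 2 * (m + 1) by omega) rfl ζ,
        cupProduct_one]
    rw [key]
    exact Submodule.smul_mem _ κ (complexGysin_mem_algebraicClasses hS μ hμ hXt hV
      (LinearSectionNet.emb ι a) (by omega) _ ha'N)
  -- (8) Künneth: `Θ = pr₁^* w + pr₂^* η`; `η ≠ 0`, `w` ambient
  obtain ⟨w, η, hΘ⟩ := exists_eq_map_fst_add_map_snd hX Θ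
  haveI := connectedSpace_complexPoints hX
  obtain ⟨x₀⟩ : Nonempty (ComplexPoints X) := inferInstance
  have hη : η ≠ 0 := by
    have h := complexBetti_map_coslice_toSegre_id_ne_zero ι hX x₀ hh₂
    rwa [complexBetti.map_comp, CategoryTheory.comp_apply, ← hΘdef, hΘ,
      map_coslice_map_fst_add_map_snd x₀ two_ne_zero] at h
  have hw : w = complexBetti.map (sliceAt X t ≫ Incidence.toSegre ι (𝟙 (projectiveSpace 1 ℂ))) 2 h₂ := by
    rw [complexBetti.map_comp, CategoryTheory.comp_apply, ← hΘdef, hΘ,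
      map_sliceAt_map_fst_add_map_snd t two_ne_zero]
  -- (9) `pr_{1*} pr₂^* η = λ • 1`, `λ ≠ 0`
  have hη1 : cupPowTwo η 1 ≠ 0 := cupPowTwo_ne_zero_projectiveSpace hη le_rfl
  obtain ⟨lam, hlam⟩ := exists_eq_smul_one μ hX
    (complexGysin μ hV hX (fst X (projectiveSpace 1 ℂ))
      (show 2 * 1 + 2 * (m + 1) = 0 + 2 * (m + 1 + 1) by omega)
      (complexBetti.map (snd X (projectiveSpace 1 ℂ)) (2 * 1) (cupPowTwo η 1)))
  have hlam0 : lam ≠ 0 := by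
    rintro rfl
    rw [zero_smul] at hlam
    exact complexGysin_fst_map_snd_ne_zero μ hX hP hη1 hlam
  -- (10) one rung of the ladder: `Φ = pr_{1*}(pr₂^* η⁰ ∪ (ζ ∪ Θ)) = w ∪ π₀ + π₁ ∈ N^{q+1}(X)`
  have hΦ : complexGysin μ hV hX (fst X (projectiveSpace 1 ℂ))
      (show 2 * (q + 1 + 1) + 2 * (m + 1) = 2 * (q + 1) + 2 * (m + 1 + 1) by omega)
      (cupProduct (show 2 * 0 + (2 * (q + 1) + 2) = 2 * (q + 1 + 1) by omega)
        (complexBetti.map (snd X (projectiveSpace 1 ℂ)) (2 * 0) (cupPowTwo η 0))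
        (cupProduct rfl ζ Θ)) ∈ algebraicClasses X (q + 1) :=
    complexGysin_mem_algebraicClasses hS μ hμ hV hX (fst X (projectiveSpace 1 ℂ))
      (by omega) _ (cupProduct_map_projectiveSpace_mem_algebraicClasses hV
        (snd X (projectiveSpace 1 ℂ)) (l := 0) (cupPowTwo η 0) hζΘ
        (s := q + 1 + 1) (by omega) (by omega))
  rw [complexGysin_fst_cupProduct_cupPowTwo_cupProduct μ hX hV w η hΘ rfl
    (show 2 * 0 + 2 * (q + 1) = 2 * (q + 1) by omega)
    (show 2 * 0 + (2 * (q + 1) + 2) = 2 * (q + 1 + 1) by omega)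
    (show 2 * (q + 1) + 2 * (m + 1) = 2 * q + 2 * (m + 1 + 1) by omega)
    (show 2 * (q + 1 + 1) + 2 * (m + 1) = 2 * (q + 1) + 2 * (m + 1 + 1) by omega)
    (show 2 * (0 + 1) + 2 * (q + 1) = 2 * (q + 1 + 1) by omega)
    (show 2 + 2 * q = 2 * (q + 1) by omega) ζ] at hΦ
  -- (11) `π₁ = λ • s_t^* ζ = λ • c`
  rw [complexGysin_fst_cupProduct_map_snd_top μ hX hP hV t (cupPowTwo η 1) lam hlam
    (show 2 * 1 + 2 * (q + 1) = 2 * (q + 1 + 1) by omega) _ ζ, hsζ] at hΦ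
  -- (12) `π₀ = pr_{1*}(pr₂^* η⁰ ∪ ζ) = pr_{1*} ζ ∈ N^q`, so `w ∪ π₀ ∈ N^{q+1}`
  have h0 : cupProduct (show 2 * 0 + 2 * (q + 1) = 2 * (q + 1) by omega)
      (complexBetti.map (snd X (projectiveSpace 1 ℂ)) (2 * 0) (cupPowTwo η 0)) ζ = ζ := by
    have h1 : complexBetti.map (snd X (projectiveSpace 1 ℂ)) (2 * 0) (cupPowTwo η 0) =
        singularCohomology.one ℂ _ := by
      rw [cupPowTwo_zero, singularCohomology.map_one]
    rw [h1]
    exact one_cupProduct ζ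
  rw [h0] at hΦ
  have hwπ : cupProduct (show 2 + 2 * q = 2 * (q + 1) by omega) w
      (complexGysin μ hV hX (fst X (projectiveSpace 1 ℂ))
        (show 2 * (q + 1) + 2 * (m + 1) = 2 * q + 2 * (m + 1 + 1) by omega) ζ) ∈
      algebraicClasses X (q + 1) := by
    rw [hw]
    exact cupProduct_map_projectiveSpace_mem_algebraicClasses hX
      (sliceAt X t ≫ Incidence.toSegre ι (𝟙 (projectiveSpace 1 ℂ))) (l := 1) h₂ hπ₀ (by omega) (by omega)
  -- (13) `λ • c ∈ N^{q+1}`, `λ ≠ 0`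
  have h := sub_mem hΦ hwπ
  rw [add_sub_cancel_left] at h
  have h' := Submodule.smul_mem _ lam⁻¹ h
  rwa [smul_smul, inv_mul_cancel₀ hlam0, one_smul] at h'

end HodgeTheory

end Literature.AlgebraicGeometry.HodgeTheory

end
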